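import Literature.NumberTheory.Sieve.IwaniecAlmostPrimesMertens
import Literature.NumberTheory.Sieve.IwaniecAlmostPrimesProp2Prep
import Literature.NumberTheory.Sieve.CoprimeSquarefreeSums
import Literature.NumberTheory.LFunctions.TaoLogChowlaMoebiusOfLiouville
import HarnessLib

/-!
# Iwaniec (1978), §4: the mean value of `ρ` on intervals, with coprimality and congruence conditions — PROVED

H. Iwaniec, *Almost-primes represented by quadratic polynomials*, Invent. Math. **47** (1978)
171–188, §4.  The dispersion argument for Proposition 1 (pp. 176–185; the named fact
`Literature.NumberTheory.Sieve.Iwaniec1978.proposition1`) evaluates three sums `W, V, U` whose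
main terms all come from ONE arithmetic input: the mean value of
`ρ(m) = #{ν mod m : ν² + 1 ≡ 0}` over `m` in an interval, restricted to `(m, Q) = 1` and to a
reduced residue class `m ≡ μ (mod d)` (`d ∣ Q` odd).  In the paper this is the first half of the
proof of Lemma 4 (p. 179, the sum `∑_{M<m<M₁, (m,q)=1, m≡μ (d)} ρ(m)`), where the printed
evaluation `ρ(m) = ∑_{a∣m} χ₄(a)` is only correct for squarefree `m` (whence the slip `π/4` for
`(6/π²)(π/4)` in the printed Lemma 4, recorded in `IwaniecAlmostPrimes.lean`).  This file PROVES
the correct elementary statement by the route of the exposition arXiv:1910.02885, §4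
(Dirichlet's hyperbola method for `ρ = μ² * χ₄`).  First file of the inline proof of
Proposition 1; everything here is PROVED, no named facts are introduced.

* `rho_odd_primePow`, `rho_two_pow_eq_zero` — `ρ(p^a) = ρ(p)` for odd `p` (the units modulo
  `p^a` are cyclic, so `x² = −1` has `φ(4) · [4 ∣ φ(p^a)]` solutions), `ρ(2^a) = 0` for `a ≥ 2`;
* `rhoArith_eq_moebiusSq_mul_chi4A` — `ρ = μ² * χ₄` as arithmetic functions
  (`∑ ρ(n) n^{-s} = ζ(s) L(s, χ₄)/ζ(2s)`);
* `abs_sfCount_sub_le` — squarefree `a ≤ W` with `(a, Q) = 1` and `a b ≡ μ (mod d)`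
  (`Q` squarefree, `d ∣ Q`, `(b, d) = (μ, d) = 1`):
  `SF = (φ(Q/d)/Q) S_Q(G) W + θ ((τ(Q) + 1) √W + 3)`, `|θ| ≤ 1`, with the TRUNCATED singular
  series `S_Q(G) = ∑_{g ≤ G, (g,Q)=1} μ(g)/g²` (any `G ≥ ⌊√W⌋`; only "the same constant in all
  three sums" matters downstream, so no infinite products are introduced);
* `abs_sum_Icc_chi4R_modEq_le_one`, `abs_sum_Ioc_chi4R_modEq_le` — `χ₄` summed over a residue
  class to an ODD modulus inside an interval is at most `1` (resp. `2`) in absolute value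
  (`χ₄(dk + c) = χ₄(d) χ₄(k + dc)`, the re-indexing `LFunctions.filter_mod_eq_image` of the
  tree, and the partial sums of `χ₄`);
* `abs_rhoSumAP_sub_le` — THE ESTIMATE: for `Q` squarefree, `d ∣ Q` odd, `(μ, d) = 1`,
  `1 ≤ E ≤ Y`, `G ≥ ⌊√Y⌋`:
  `|∑_{m ≤ Y, (m,Q)=1, m≡μ (d)} ρ(m) − (φ(Q/d)/Q) S_Q(G) Λ_Q(E) Y| ≤ (2τ(Q) + 7)(√Y √E + Y/E)`,
  `Λ_Q(E) = ∑_{b ≤ E, (b,Q)=1} χ₄(b)/b`; with `E ≈ Y^{1/3}` the error is `O(τ(Q) Y^{2/3})`.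

The main term is `(κ/φ(d)) · Y` with `κ = (φ(Q)/Q) S_Q(G) Λ_Q(E)` independent of the class `μ`
and depending on `d` only through `φ(Q/d) = φ(Q)/φ(d)` — the one feature the dispersion identity
uses.  Constants are crude and explicit.

## References

* H. Iwaniec, Invent. Math. 47 (1978) 171–188, §4, proof of Lemma 4 (`IwaniecInventiones1978`).
* arXiv:1910.02885 (2019), §4, Proposition 6 and Lemma 12 (the `6/π²` correction).
-/

noncomputable section

open Finset Real

namespace Literature.NumberTheory.Sieve.Iwaniec1978

open FriedlanderIwaniecPrimes (chi4R chi4R_eq_ite chi4R_mul abs_chi4R_le_one chi4R_zero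
  chi4R_one)
open SquarefreeSums (sum_Icc_sum_divisorsAntidiagonal mul_apply_prime_pow)

/-! ### `ρ` on prime powers -/

/-- `ρ(2^a) = 0` for `a ≥ 2`: `ν² + 1 ≢ 0 (mod 4)`. [folklore] -/
theorem rho_two_pow_eq_zero {a : ℕ} (ha : 2 ≤ a) : rho (2 ^ a) = 0 := by
  unfold rho
  rw [Finset.card_eq_zero, Finset.filter_eq_empty_iff]
  intro ν _ h
  have h4 : 4 ∣ ν ^ 2 + 1 := (show (4 : ℕ) = 2 ^ 2 by norm_num) ▸ (pow_dvd_pow 2 ha).trans h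
  have key : (ν ^ 2 + 1) % 4 = ((ν % 4) ^ 2 + 1) % 4 := by
    rw [Nat.add_mod, Nat.pow_mod]
    conv_rhs => rw [Nat.add_mod, Nat.pow_mod, Nat.mod_mod]
  have hm : ν % 4 < 4 := Nat.mod_lt ν (by norm_num)
  have h0 : ((ν % 4) ^ 2 + 1) % 4 = 0 := by rw [← key]; exact Nat.mod_eq_zero_of_dvd h4
  generalize ν % 4 = m at hm h0
  interval_cases m <;> norm_num at h0

/-- For an odd prime power `p^a` (`a ≥ 1`) the congruence `x² + 1 ≡ 0 (mod p^a)` has `2` solutions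
if `4 ∣ p − 1` and none otherwise: a solution is a unit of order `4`, the unit group is cyclic of
order `φ(p^a) = p^{a−1}(p − 1)`, and a cyclic group has `φ(4) = 2` elements of order `4` when
`4` divides its order (and none otherwise). [folklore] -/
theorem rho_odd_primePow_eq_ite {p : ℕ} (hp : p.Prime) (hp2 : p ≠ 2) {a : ℕ} (ha : a ≠ 0) :
    rho (p ^ a) = if 4 ∣ p - 1 then 2 else 0 := by
  classical
  have hp3 : 3 ≤ p := by have := hp.two_le; omega
  have ha1 : 1 ≤ a := Nat.one_le_iff_ne_zero.mpr ha
  have hn2 : 2 < p ^ a :=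
    calc 2 < 3 := by norm_num
      _ ≤ p := hp3
      _ = p ^ 1 := (pow_one p).symm
      _ ≤ p ^ a := Nat.pow_le_pow_right hp.pos ha1
  haveI : Fact (2 < p ^ a) := ⟨hn2⟩
  haveI : NeZero (p ^ a) := ⟨pow_ne_zero _ hp.ne_zero⟩
  haveI : IsCyclic (ZMod (p ^ a))ˣ := ZMod.isCyclic_units_of_prime_pow p hp hp2 a
  rw [rho_eq_card_filter_zmod]
  have hcard : Fintype.card (ZMod (p ^ a))ˣ = Nat.totient (p ^ a) := ZMod.card_units_eq_totient _
  -- `-1 ≠ 1` among the units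
  have hneg1 : (-1 : (ZMod (p ^ a))ˣ) ≠ 1 := by
    intro h
    have h' : ((-1 : (ZMod (p ^ a))ˣ) : ZMod (p ^ a)) = ((1 : (ZMod (p ^ a))ˣ) : ZMod (p ^ a)) := by
      rw [h]
    rw [Units.val_neg, Units.val_one] at h'
    exact ZMod.neg_one_ne_one h'
  haveI : Fact (Nat.Prime 2) := ⟨Nat.prime_two⟩
  have horder_neg : orderOf (-1 : (ZMod (p ^ a))ˣ) = 2 := by
    rw [orderOf_eq_prime_iff]
    exact ⟨by rw [neg_one_sq], hneg1⟩
  -- the unique element of order `2` is `-1`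
  have horder2 : ∀ w : (ZMod (p ^ a))ˣ, orderOf w = 2 → w = -1 := by
    intro w hw
    have h2dvd : 2 ∣ Fintype.card (ZMod (p ^ a))ˣ := by
      rw [hcard]; exact even_iff_two_dvd.mp (Nat.totient_even hn2)
    have hone : (Finset.univ.filter fun u : (ZMod (p ^ a))ˣ => orderOf u = 2).card = 1 := by
      rw [IsCyclic.card_orderOf_eq_totient h2dvd, Nat.totient_two]
    obtain ⟨u0, hu0⟩ := Finset.card_eq_one.mp hone
    have hw' : w ∈ (Finset.univ.filter fun u : (ZMod (p ^ a))ˣ => orderOf u = 2) := by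
      simp [hw]
    have hn' : (-1 : (ZMod (p ^ a))ˣ) ∈
        (Finset.univ.filter fun u : (ZMod (p ^ a))ˣ => orderOf u = 2) := by
      simp [horder_neg]
    rw [hu0, Finset.mem_singleton] at hw' hn'
    rw [hw', hn']
  -- for a unit: order `4` iff its square is `-1`
  have hiff : ∀ u : (ZMod (p ^ a))ˣ, orderOf u = 4 ↔ u ^ 2 = -1 := by
    intro u
    constructor
    · intro hu
      apply horder2
      rw [orderOf_eq_prime_iff]
      refine ⟨?_, ?_⟩
      · rw [← pow_mul, show 2 * 2 = 4 by norm_num, ← hu, pow_orderOf_eq_one]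
      · intro h1
        have : orderOf u ∣ 2 := orderOf_dvd_of_pow_eq_one h1
        rw [hu] at this
        omega
    · intro hu
      have h4 : u ^ 4 = 1 := by
        rw [show (4 : ℕ) = 2 * 2 by norm_num, pow_mul, hu, neg_one_sq]
      have hdvd : orderOf u ∣ 4 := orderOf_dvd_of_pow_eq_one h4
      have hle : orderOf u ≤ 4 := Nat.le_of_dvd (by norm_num) hdvd
      have hne2 : ¬ orderOf u ∣ 2 := by
        intro h2
        have : u ^ 2 = 1 := orderOf_dvd_iff_pow_eq_one.mp h2
        rw [hu] at this
        exact hneg1 this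
      interval_cases h : orderOf u <;> omega
  -- counting the units of order `4` in the cyclic unit group
  have htot : Nat.totient (p ^ a) = p ^ (a - 1) * (p - 1) := Nat.totient_prime_pow hp ha1
  have hcop : Nat.Coprime 4 (p ^ (a - 1)) := by
    have h2p : Nat.Coprime 2 p := (Nat.coprime_primes Nat.prime_two hp).mpr (Ne.symm hp2)
    simpa using (h2p.pow_left 2).pow_right (a - 1)
  have h4iff : 4 ∣ Fintype.card (ZMod (p ^ a))ˣ ↔ 4 ∣ p - 1 := by
    rw [hcard, htot]
    exact hcop.dvd_mul_left
  have hT : (Finset.univ.filter fun u : (ZMod (p ^ a))ˣ => orderOf u = 4).card =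
      if 4 ∣ p - 1 then 2 else 0 := by
    split_ifs with h4
    · rw [IsCyclic.card_orderOf_eq_totient (h4iff.mpr h4),
        show (4 : ℕ) = 2 ^ 2 by norm_num, Nat.totient_prime_pow Nat.prime_two (by norm_num)]
      norm_num
    · rw [Finset.card_eq_zero, Finset.filter_eq_empty_iff]
      intro u _ hu
      exact h4 (h4iff.mp (hu ▸ orderOf_dvd_card))
  -- the bijection between the roots of `x² + 1` and the units of order `4`
  rw [← hT]
  symm
  refine Finset.card_bij (fun u _ => (u : ZMod (p ^ a))) ?_ ?_ ?_
  · intro u hu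
    rw [Finset.mem_filter] at hu
    rw [Finset.mem_filter]
    refine ⟨Finset.mem_univ _, ?_⟩
    have h := (hiff u).mp hu.2
    have h' : ((u ^ 2 : (ZMod (p ^ a))ˣ) : ZMod (p ^ a)) =
        ((-1 : (ZMod (p ^ a))ˣ) : ZMod (p ^ a)) := by
      rw [h]
    rw [Units.val_pow_eq_pow_val, Units.val_neg, Units.val_one] at h'
    rw [h', neg_add_cancel]
  · intro u _ v _ h
    exact Units.ext h
  · intro x hx
    rw [Finset.mem_filter] at hx
    have hx2 : x ^ 2 = -1 := eq_neg_of_add_eq_zero_left hx.2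
    have hmul : x * (-x) = 1 := by rw [mul_neg, ← sq, hx2, neg_neg]
    refine ⟨Units.mkOfMulEqOne x (-x) hmul, ?_, rfl⟩
    rw [Finset.mem_filter]
    refine ⟨Finset.mem_univ _, (hiff _).mpr ?_⟩
    ext
    rw [Units.val_pow_eq_pow_val, Units.val_mkOfMulEqOne, hx2, Units.val_neg, Units.val_one]

/-- **`ρ(p^a) = ρ(p)` for an odd prime `p` and `a ≥ 1`** (both equal `2` if `p ≡ 1 (mod 4)` and
`0` otherwise). [folklore] -/
theorem rho_odd_primePow {p : ℕ} (hp : p.Prime) (hp2 : p ≠ 2) {a : ℕ} (ha : a ≠ 0) :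
    rho (p ^ a) = rho p := by
  rw [rho_odd_primePow_eq_ite hp hp2 ha, ← rho_odd_primePow_eq_ite hp hp2 one_ne_zero, pow_one]

/-! ### `ρ = μ² * χ₄` -/

/-- `μ²`, the indicator of the squarefree numbers, as a real arithmetic function. [folklore] -/
def moebiusSq : ArithmeticFunction ℝ :=
  ⟨fun n => if Squarefree n then 1 else 0, by simp⟩

/-- Unfolding `moebiusSq`. [folklore] -/
theorem moebiusSq_apply (n : ℕ) : moebiusSq n = if Squarefree n then 1 else 0 := rfl

/-- `μ²` is multiplicative. [folklore] -/
theorem isMultiplicative_moebiusSq : moebiusSq.IsMultiplicative := by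
  refine ⟨by simp [moebiusSq_apply], fun {m n} hmn => ?_⟩
  simp only [moebiusSq_apply, Nat.squarefree_mul_iff]
  by_cases hm : Squarefree m <;> by_cases hn : Squarefree n <;> simp [hm, hn, hmn]

/-- `μ²(p^i) = [i ≤ 1]`. [folklore] -/
theorem moebiusSq_primePow {p : ℕ} (hp : p.Prime) (i : ℕ) :
    moebiusSq (p ^ i) = if i ≤ 1 then 1 else 0 := by
  rw [moebiusSq_apply]
  rcases Nat.lt_or_ge i 2 with hi | hi
  · interval_cases i
    · simp
    · simp [hp.squarefree]
  · rw [if_neg, if_neg (by omega)]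
    rw [Nat.squarefree_pow_iff hp.ne_one (by omega)]
    rintro ⟨-, h⟩
    omega

/-- `χ₄` as a real arithmetic function. [folklore] -/
def chi4A : ArithmeticFunction ℝ := ⟨fun n => chi4R n, chi4R_zero⟩

/-- Unfolding `chi4A`. [folklore] -/
theorem chi4A_apply (n : ℕ) : chi4A n = chi4R n := rfl

/-- `χ₄` is (completely) multiplicative. [folklore] -/
theorem isMultiplicative_chi4A : chi4A.IsMultiplicative :=
  ⟨chi4R_one, fun {m n} _ => chi4R_mul m n⟩

/-- `χ₄(n^k) = χ₄(n)^k`. [folklore] -/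
theorem chi4R_pow (n k : ℕ) : chi4R (n ^ k) = chi4R n ^ k := by
  induction k with
  | zero => simp [chi4R_one]
  | succ k ih => rw [pow_succ, chi4R_mul, ih, pow_succ]

/-- `χ₄(2) = 0`. [folklore] -/
theorem chi4R_two : chi4R 2 = 0 := by rw [chi4R_eq_ite]; norm_num

/-- `χ₄(p) = ±1` for an odd prime `p`. [folklore] -/
theorem chi4R_prime_eq_or {p : ℕ} (hp : p.Prime) (hp2 : p ≠ 2) : chi4R p = 1 ∨ chi4R p = -1 := by
  have hodd : p % 2 = 1 := by
    rcases hp.eq_two_or_odd with h | h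
    · exact absurd h hp2
    · exact h
  rw [chi4R_eq_ite, if_neg (by omega)]
  split_ifs <;> simp

/-- **`ρ = μ² * χ₄`** (Dirichlet convolution): both sides are multiplicative and agree on prime
powers (`ρ(p^a) = 1 + χ₄(p) = χ₄(p)^{a−1}(χ₄(p) + 1)` for odd `p`, `ρ(2) = 1`, `ρ(2^a) = 0` for
`a ≥ 2`).  Equivalently `∑ ρ(n) n^{-s} = ζ(s) L(s, χ₄)/ζ(2s)`. [folklore] -/
theorem rhoArith_eq_moebiusSq_mul_chi4A : rhoArith = moebiusSq * chi4A := by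
  rw [isMultiplicative_rhoArith.eq_iff_eq_on_prime_powers _ _
    (isMultiplicative_moebiusSq.mul isMultiplicative_chi4A)]
  intro p i hp
  rw [mul_apply_prime_pow _ _ hp, rhoArith_apply]
  rcases Nat.eq_zero_or_pos i with rfl | hi
  · rw [Finset.sum_range_one]
    norm_num [moebiusSq_apply, chi4A_apply, rho_one, chi4R_one]
  obtain ⟨j, rfl⟩ : ∃ j, i = j + 1 := ⟨i - 1, by omega⟩
  rw [Finset.sum_range_succ', Finset.sum_range_succ']
  have hzero : ∑ k ∈ Finset.range j,
      moebiusSq (p ^ (k + 1 + 1)) * chi4A (p ^ (j + 1 - (k + 1 + 1))) = 0 := by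
    refine Finset.sum_eq_zero fun k _ => ?_
    rw [moebiusSq_primePow hp, if_neg (by omega), zero_mul]
  rw [hzero, zero_add, moebiusSq_primePow hp, moebiusSq_primePow hp, if_pos (le_refl 1),
    if_pos (Nat.zero_le 1), one_mul, one_mul, chi4A_apply, chi4A_apply,
    show j + 1 - (0 + 1) = j by omega, Nat.sub_zero, chi4R_pow, chi4R_pow]
  by_cases hp2 : p = 2
  · subst hp2
    rw [chi4R_two]
    rcases Nat.eq_zero_or_pos j with rfl | hj
    · rw [show rho (2 ^ (0 + 1)) = 1 by decide]; norm_num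
    · rw [rho_two_pow_eq_zero (by omega), zero_pow hj.ne', zero_pow (by omega)]; norm_num
  · rw [rho_odd_primePow hp hp2 (by omega), rho_prime_eq_one_add_chi4R hp]
    rcases chi4R_prime_eq_or hp hp2 with h | h
    · rw [h]; norm_num
    · rw [h, pow_succ]
      ring

/-- `ρ(n) = ∑_{ab = n} μ²(a) χ₄(b)` pointwise. [folklore] -/
theorem rho_eq_sum_divisorsAntidiagonal (n : ℕ) :
    (rho n : ℝ) = ∑ q ∈ n.divisorsAntidiagonal, moebiusSq q.1 * chi4R q.2 := by
  have h := congrArg (fun f : ArithmeticFunction ℝ => f n) rhoArith_eq_moebiusSq_mul_chi4A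
  simp only [rhoArith_apply, ArithmeticFunction.mul_apply] at h
  exact h

/-! ### Counting lemmas: Möbius detection of squarefree numbers and of coprimality -/

/-- `g² ∣ b² c` with `c` squarefree forces `g ∣ b`. [folklore] -/
theorem dvd_of_sq_dvd_sq_mul {g b c : ℕ} (hc : Squarefree c) (hb : b ≠ 0) (h : g ^ 2 ∣ b ^ 2 * c) :
    g ∣ b := by
  have hc0 : c ≠ 0 := hc.ne_zero
  have hg : g ≠ 0 := by
    rintro rfl
    rw [zero_pow two_ne_zero, zero_dvd_iff] at h
    exact mul_ne_zero (pow_ne_zero 2 hb) hc0 h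
  rw [← Nat.factorization_le_iff_dvd hg hb]
  intro p
  have h1 := (Nat.factorization_le_iff_dvd (pow_ne_zero 2 hg)
    (mul_ne_zero (pow_ne_zero 2 hb) hc0)).mpr h p
  rw [Nat.factorization_mul (pow_ne_zero 2 hb) hc0, Nat.factorization_pow, Nat.factorization_pow,
    Finsupp.add_apply, Finsupp.smul_apply, Finsupp.smul_apply, smul_eq_mul, smul_eq_mul] at h1
  have h2 : c.factorization p ≤ 1 := (Nat.squarefree_iff_factorization_le_one hc0).mp hc p
  omega

/-- `∑_{d ∣ n} μ(d) = [n = 1]` (over `ℝ`). [folklore] -/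
theorem sum_divisors_moebius_eq_ite (n : ℕ) :
    ∑ i ∈ n.divisors, (ArithmeticFunction.moebius i : ℝ) = if n = 1 then 1 else 0 := by
  have hz : ∑ i ∈ n.divisors, (ArithmeticFunction.moebius i : ℤ) = if n = 1 then 1 else 0 := by
    rw [← ArithmeticFunction.coe_mul_zeta_apply, ArithmeticFunction.moebius_mul_coe_zeta,
      ArithmeticFunction.one_apply]
  have := congrArg (fun z : ℤ => (z : ℝ)) hz
  push_cast at this
  rw [this]

/-- **Möbius detection of squarefree numbers**: for `1 ≤ a ≤ W`,
`∑_{g ≤ W, g² ∣ a} μ(g) = μ²(a)` (write `a = b² c` with `c` squarefree; then `g² ∣ a ⇔ g ∣ b`).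
[folklore] -/
theorem sum_moebius_filter_sq_dvd {a W : ℕ} (ha : 0 < a) (haW : a ≤ W) :
    ∑ g ∈ (Ioc 0 W).filter (fun g => g ^ 2 ∣ a), (ArithmeticFunction.moebius g : ℝ) =
      if Squarefree a then 1 else 0 := by
  obtain ⟨c, b, hc, hb, hba, hcsq⟩ := Nat.sq_mul_squarefree_of_pos ha
  have hset : (Ioc 0 W).filter (fun g => g ^ 2 ∣ a) = b.divisors := by
    ext g
    simp only [Finset.mem_filter, Finset.mem_Ioc, Nat.mem_divisors]
    constructor
    · rintro ⟨-, hg⟩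
      rw [← hba] at hg
      exact ⟨dvd_of_sq_dvd_sq_mul hcsq hb.ne' hg, hb.ne'⟩
    · rintro ⟨hg, -⟩
      have hgpos : 0 < g := Nat.pos_of_dvd_of_pos hg hb
      have hgb : g ≤ b := Nat.le_of_dvd hb hg
      have hba' : b ≤ a := by
        rw [← hba]
        calc b = b * 1 * 1 := by ring
          _ ≤ b * b * c := by gcongr <;> omega
          _ = b ^ 2 * c := by ring
      refine ⟨⟨hgpos, by omega⟩, ?_⟩
      rw [← hba]
      exact (pow_dvd_pow_of_dvd hg 2).trans (dvd_mul_right _ _)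
  rw [hset, sum_divisors_moebius_eq_ite]
  have hiff : b = 1 ↔ Squarefree a := by
    constructor
    · rintro rfl
      rw [← hba]; simpa using hcsq
    · intro hsq
      rw [← hba] at hsq
      have : IsUnit b := hsq b ⟨c, by ring⟩
      exact Nat.isUnit_iff.mp this
  by_cases h : b = 1
  · rw [if_pos h, if_pos (hiff.mp h)]
  · rw [if_neg h, if_neg (fun h' => h (hiff.mpr h'))]

/-- **Möbius detection of coprimality**: for `a ≠ 0`, `[(a, Q) = 1] = ∑_{f ∣ Q, f ∣ a} μ(f)`.
[folklore] -/
theorem ite_coprime_eq_sum_moebius {a Q : ℕ} (ha : a ≠ 0) (hQ : Q ≠ 0) :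
    (if a.Coprime Q then (1 : ℝ) else 0) =
      ∑ f ∈ Q.divisors.filter (fun f => f ∣ a), (ArithmeticFunction.moebius f : ℝ) := by
  have hset : Q.divisors.filter (fun f => f ∣ a) = (a.gcd Q).divisors := by
    ext f
    simp only [Finset.mem_filter, Nat.mem_divisors, Nat.dvd_gcd_iff]
    constructor
    · rintro ⟨⟨hfQ, -⟩, hfa⟩
      exact ⟨⟨hfa, hfQ⟩, Nat.gcd_ne_zero_left ha⟩
    · rintro ⟨⟨hfa, hfQ⟩, -⟩
      exact ⟨⟨hfQ, hQ⟩, hfa⟩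
  rw [hset, sum_divisors_moebius_eq_ite]

/-- The two conditions `e ∣ a` and `a ≡ ν (mod d)` with `(e, d) = 1` cut out a single residue class
modulo `e d` (Chinese remainder theorem). [folklore] -/
theorem exists_dvd_and_modEq_iff {e d : ℕ} (hed : e.Coprime d) (ν : ℕ) :
    ∃ c : ℕ, ∀ a : ℕ, (e ∣ a ∧ a ≡ ν [MOD d]) ↔ a ≡ c [MOD e * d] := by
  obtain ⟨c, hc⟩ := Nat.chineseRemainder hed 0 ν
  refine ⟨c, fun a => ?_⟩
  rw [← Nat.modEq_and_modEq_iff_modEq_mul hed, ← Nat.modEq_zero_iff_dvd]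
  exact ⟨fun h => ⟨h.1.trans hc.1.symm, h.2.trans hc.2.symm⟩,
    fun h => ⟨h.1.trans hc.1, h.2.trans hc.2⟩⟩

/-- A multiplier `b` prime to `d` can be moved to the other side of a congruence:
`a b ≡ μ (mod d) ⇔ a ≡ μ' (mod d)` for a suitable `μ'` (namely `μ b̄`). [folklore] -/
theorem exists_mul_modEq_iff {b d : ℕ} (hd : 0 < d) (hbd : b.Coprime d) (μ : ℕ) :
    ∃ μ' : ℕ, ∀ a : ℕ, a * b ≡ μ [MOD d] ↔ a ≡ μ' [MOD d] := by
  haveI : NeZero d := ⟨hd.ne'⟩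
  have hu : IsUnit (b : ZMod d) := (ZMod.isUnit_iff_coprime b d).mpr hbd
  refine ⟨((μ : ZMod d) * (hu.unit⁻¹ : (ZMod d)ˣ)).val, fun a => ?_⟩
  rw [← ZMod.natCast_eq_natCast_iff, ← ZMod.natCast_eq_natCast_iff, ZMod.natCast_val,
    ZMod.cast_id', id, Nat.cast_mul]
  constructor
  · intro h
    rw [← h, mul_assoc, IsUnit.mul_val_inv, mul_one]
  · intro h
    rw [h, mul_assoc, IsUnit.val_inv_mul, mul_one]

/-- Counting a residue class in `(0, W]`: `|#{a ≤ W : a ≡ c (mod m)} − W/m| ≤ 1`. [folklore] -/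
theorem abs_card_Ioc_modEq_sub_le {m : ℕ} (hm : 0 < m) (W c : ℕ) :
    |(((Ioc 0 W).filter fun a : ℕ => a ≡ c [MOD m]).card : ℝ) - W / m| ≤ 1 := by
  have h := Nat.Ioc_filter_modEq_card 0 W hm c
  have hm' : (0 : ℚ) < m := by exact_mod_cast hm
  set A : ℚ := ((W : ℕ) - c : ℚ) / m with hA
  set B : ℚ := ((0 : ℕ) - c : ℚ) / m with hB
  have hBA : B ≤ A := by
    rw [hA, hB]
    exact div_le_div_of_nonneg_right (sub_le_sub_right (by exact_mod_cast Nat.zero_le W) _) hm'.le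
  rw [max_eq_left (sub_nonneg.2 (Int.floor_mono hBA))] at h
  have hAB : A - B = (W : ℚ) / m := by rw [hA, hB]; push_cast; field_simp; ring
  have key : |((((Ioc 0 W).filter fun a : ℕ => a ≡ c [MOD m]).card : ℕ) : ℚ) - (W : ℚ) / m| ≤ 1 := by
    have h' : ((((Ioc 0 W).filter fun a : ℕ => a ≡ c [MOD m]).card : ℕ) : ℚ) =
        ((⌊A⌋ - ⌊B⌋ : ℤ) : ℚ) := by exact_mod_cast h
    push_cast at h'
    rw [h', ← hAB, abs_le]
    constructor <;>
      linarith [Int.floor_le A, Int.lt_floor_add_one A, Int.floor_le B, Int.lt_floor_add_one B]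
  have := (Rat.cast_le (K := ℝ)).2 key
  push_cast at this
  exact this

/-- `N(e) = #{1 ≤ a ≤ W : e ∣ a, a b ≡ μ (mod d)}`, the count behind `sfCount`. [folklore] -/
def dvdCongrCount (W e d b μ : ℕ) : ℕ :=
  ((Ioc 0 W).filter fun a => e ∣ a ∧ a * b ≡ μ [MOD d]).card

/-- **`N(e) = W/(e d) + O(1)`** when `(e b, d) = 1`: the conditions form one class modulo `e d`.
[folklore] -/
theorem abs_dvdCongrCount_sub_le {W e d b μ : ℕ} (he : 0 < e) (hd : 0 < d) (hed : e.Coprime d)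
    (hbd : b.Coprime d) :
    |(dvdCongrCount W e d b μ : ℝ) - W / (e * d)| ≤ 1 := by
  obtain ⟨μ', hμ'⟩ := exists_mul_modEq_iff hd hbd μ
  obtain ⟨c, hc⟩ := exists_dvd_and_modEq_iff hed μ'
  unfold dvdCongrCount
  have hset : ((Ioc 0 W).filter fun a => e ∣ a ∧ a * b ≡ μ [MOD d]) =
      (Ioc 0 W).filter fun a => a ≡ c [MOD e * d] := by
    refine Finset.filter_congr fun a _ => ?_
    rw [hμ' a, hc a]
  rw [hset]
  have := abs_card_Ioc_modEq_sub_le (Nat.mul_pos he hd) W c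
  push_cast at this ⊢
  exact this

/-! ### Squarefree numbers with coprimality and congruence conditions -/

/-- `SF(W; Q, d, b, μ) = #{1 ≤ a ≤ W : a squarefree, (a, Q) = 1, a b ≡ μ (mod d)}`.
[cite: IwaniecInventiones1978, §4 proof of Lemma 4] -/
def sfCount (W Q d b μ : ℕ) : ℕ :=
  ((Ioc 0 W).filter fun a => Squarefree a ∧ a.Coprime Q ∧ a * b ≡ μ [MOD d]).card

/-- The truncated singular series `S_Q(G) = ∑_{g ≤ G, (g, Q) = 1} μ(g)/g²`
(`→ (6/π²) ∏_{p ∣ Q} (1 − p^{-2})^{-1}`, not needed). [folklore] -/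
def sqfSeries (Q G : ℕ) : ℝ :=
  ∑ g ∈ (Ioc 0 G).filter (fun g => g.Coprime Q), (ArithmeticFunction.moebius g : ℝ) / (g : ℝ) ^ 2

/-- `|S_Q(G) − S_Q(K)| ≤ 1/K` for `1 ≤ K ≤ G`. [folklore] -/
theorem abs_sqfSeries_sub_le {Q K G : ℕ} (hK : 0 < K) (hKG : K ≤ G) :
    |sqfSeries Q G - sqfSeries Q K| ≤ 1 / K := by
  unfold sqfSeries
  have hsplit : (Ioc 0 G).filter (fun g => g.Coprime Q) =
      (Ioc 0 K).filter (fun g => g.Coprime Q) ∪ (Ioc K G).filter (fun g => g.Coprime Q) := by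
    rw [← Finset.filter_union, Finset.Ioc_union_Ioc_eq_Ioc (Nat.zero_le K) hKG]
  have hdisj : Disjoint ((Ioc 0 K).filter (fun g => g.Coprime Q))
      ((Ioc K G).filter (fun g => g.Coprime Q)) := by
    refine Finset.disjoint_filter_filter (Finset.disjoint_left.mpr fun x hx hx' => ?_)
    rw [Finset.mem_Ioc] at hx hx'
    omega
  rw [hsplit, Finset.sum_union hdisj, add_sub_cancel_left]
  calc |∑ g ∈ (Ioc K G).filter (fun g => g.Coprime Q), (ArithmeticFunction.moebius g : ℝ) / (g : ℝ) ^ 2|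
      ≤ ∑ g ∈ (Ioc K G).filter (fun g => g.Coprime Q), |(ArithmeticFunction.moebius g : ℝ) / (g : ℝ) ^ 2| :=
        Finset.abs_sum_le_sum_abs _ _
    _ ≤ ∑ g ∈ (Ioc K G).filter (fun g => g.Coprime Q), ((g : ℝ) ^ 2)⁻¹ := by
        refine Finset.sum_le_sum fun g _ => ?_
        rw [abs_div, abs_of_nonneg (by positivity : (0 : ℝ) ≤ (g : ℝ) ^ 2), div_eq_mul_inv]
        have : |(ArithmeticFunction.moebius g : ℝ)| ≤ 1 := by
          exact_mod_cast ArithmeticFunction.abs_moebius_le_one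
        exact mul_le_of_le_one_left (inv_nonneg.mpr (sq_nonneg _)) this
    _ ≤ ∑ g ∈ Ioc K G, ((g : ℝ) ^ 2)⁻¹ :=
        Finset.sum_le_sum_of_subset_of_nonneg (Finset.filter_subset _ _) fun _ _ _ => by positivity
    _ ≤ (K : ℝ)⁻¹ - (G : ℝ)⁻¹ := sum_Ioc_inv_sq_le_sub hK.ne' hKG
    _ ≤ 1 / K := by rw [one_div]; linarith [inv_nonneg.mpr (Nat.cast_nonneg G : (0 : ℝ) ≤ G)]

/-- `|S_Q(G)| ≤ 2`. [folklore] -/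
theorem abs_sqfSeries_le (Q G : ℕ) : |sqfSeries Q G| ≤ 2 := by
  rcases Nat.eq_zero_or_pos G with rfl | hG
  · simp [sqfSeries]
  have h1 : sqfSeries Q 1 = 1 := by
    unfold sqfSeries
    rw [show Ioc 0 1 = {1} by rfl, Finset.filter_singleton, if_pos (Nat.coprime_one_left Q),
      Finset.sum_singleton]
    simp
  have h := abs_sqfSeries_sub_le (Q := Q) Nat.one_pos hG
  rw [h1] at h
  have : |sqfSeries Q G| ≤ |sqfSeries Q G - 1| + |(1 : ℝ)| := by
    have := abs_add_le (sqfSeries Q G - 1) 1; rwa [sub_add_cancel] at this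
  rw [abs_one] at this
  norm_num at h
  linarith

section SF

variable {W Q d b μ : ℕ}

/-- The combinatorial identity behind `sfCount`: with `K = ⌊√W⌋` and `Q' = Q/d`,
`SF(W) = ∑_{g ≤ K, (g,Q)=1} μ(g) ∑_{f ∣ Q'} μ(f) N(g² f)`. [folklore] -/
theorem sfCount_eq_sum (hQ : Squarefree Q) (hdQ : d ∣ Q) (hμ : μ.Coprime d) :
    (sfCount W Q d b μ : ℝ) =
      ∑ g ∈ (Ioc 0 (Nat.sqrt W)).filter (fun g => g.Coprime Q),
        (ArithmeticFunction.moebius g : ℝ) *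
          ∑ f ∈ (Q / d).divisors, (ArithmeticFunction.moebius f : ℝ) *
            (dvdCongrCount W (g ^ 2 * f) d b μ : ℝ) := by
  classical
  have hQ0 : Q ≠ 0 := hQ.ne_zero
  have hd0 : 0 < d := Nat.pos_of_dvd_of_pos hdQ (Nat.pos_of_ne_zero hQ0)
  set Q' := Q / d with hQ'
  have hQeq : Q' * d = Q := Nat.div_mul_cancel hdQ
  have hQ'0 : Q' ≠ 0 := by intro h; rw [h, zero_mul] at hQeq; exact hQ0 hQeq.symm
  have hQ'd : Q'.Coprime d := by
    have := hQ; rw [← hQeq, Nat.squarefree_mul_iff] at this; exact this.1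
  -- every element of the counted sets is prime to `d`
  have hcopd : ∀ a : ℕ, a * b ≡ μ [MOD d] → a.Coprime d := by
    intro a h
    have h1 : (a * b).Coprime d := by
      rw [Nat.Coprime, Nat.ModEq.gcd_eq h]; exact hμ
    exact Nat.Coprime.coprime_mul_right h1
  -- Step 1: Möbius detection of squarefreeness, then swap.
  set A := (Ioc 0 W).filter (fun a => a.Coprime Q ∧ a * b ≡ μ [MOD d]) with hA
  have h1 : (sfCount W Q d b μ : ℝ) = ∑ a ∈ A, (if Squarefree a then (1 : ℝ) else 0) := by
    unfold sfCount
    have : ((Ioc 0 W).filter fun a => Squarefree a ∧ a.Coprime Q ∧ a * b ≡ μ [MOD d]) =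
        A.filter Squarefree := by
      ext a; simp only [hA, Finset.mem_filter]; tauto
    rw [this, Finset.card_filter]
    push_cast
    rfl
  have h2 : ∑ a ∈ A, (if Squarefree a then (1 : ℝ) else 0) =
      ∑ g ∈ Ioc 0 W, (ArithmeticFunction.moebius g : ℝ) * ((A.filter fun a => g ^ 2 ∣ a).card : ℝ) := by
    have : ∀ a ∈ A, (if Squarefree a then (1 : ℝ) else 0) =
        ∑ g ∈ Ioc 0 W, if g ^ 2 ∣ a then (ArithmeticFunction.moebius g : ℝ) else 0 := by
      intro a ha
      rw [hA, Finset.mem_filter, Finset.mem_Ioc] at ha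
      rw [← Finset.sum_filter, sum_moebius_filter_sq_dvd ha.1.1 ha.1.2]
    rw [Finset.sum_congr rfl this, Finset.sum_comm]
    refine Finset.sum_congr rfl fun g _ => ?_
    rw [← Finset.sum_filter, Finset.sum_const, nsmul_eq_mul, mul_comm]
  -- Step 2: the inner count, for `g` prime to `Q`, via Möbius detection of coprimality to `Q'`.
  have h3 : ∀ g : ℕ, 0 < g → g.Coprime Q →
      ((A.filter fun a => g ^ 2 ∣ a).card : ℝ) =
        ∑ f ∈ Q'.divisors, (ArithmeticFunction.moebius f : ℝ) * (dvdCongrCount W (g ^ 2 * f) d b μ : ℝ) := by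
    intro g hg hgQ
    set B := (Ioc 0 W).filter (fun a => g ^ 2 ∣ a ∧ a * b ≡ μ [MOD d]) with hB
    have hAB : (A.filter fun a => g ^ 2 ∣ a) = B.filter (fun a => a.Coprime Q') := by
      ext a
      simp only [hA, hB, Finset.mem_filter, Finset.mem_Ioc]
      constructor
      · rintro ⟨⟨hw, haQ, hab⟩, hga⟩
        refine ⟨⟨hw, hga, hab⟩, ?_⟩
        exact Nat.Coprime.coprime_dvd_right (Dvd.intro d hQeq) haQ
      · rintro ⟨⟨hw, hga, hab⟩, haQ'⟩
        refine ⟨⟨hw, ?_, hab⟩, hga⟩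
        rw [← hQeq]
        exact Nat.Coprime.mul_right haQ' (hcopd a hab)
    rw [hAB, Finset.card_filter]
    push_cast
    have : ∀ a ∈ B, (if a.Coprime Q' then (1 : ℝ) else 0) =
        ∑ f ∈ Q'.divisors, if f ∣ a then (ArithmeticFunction.moebius f : ℝ) else 0 := by
      intro a ha
      rw [hB, Finset.mem_filter, Finset.mem_Ioc] at ha
      rw [← Finset.sum_filter, ite_coprime_eq_sum_moebius (by omega) hQ'0]
    rw [Finset.sum_congr rfl this, Finset.sum_comm]
    refine Finset.sum_congr rfl fun f hf => ?_
    rw [← Finset.sum_filter, Finset.sum_const, nsmul_eq_mul, mul_comm]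
    congr 1
    have hfQ' : f ∣ Q' := Nat.dvd_of_mem_divisors hf
    have hcop : (g ^ 2).Coprime f :=
      Nat.Coprime.pow_left 2 (Nat.Coprime.coprime_dvd_right (hfQ'.trans (Dvd.intro d hQeq)) hgQ)
    have hset : B.filter (fun a => f ∣ a) =
        (Ioc 0 W).filter (fun a => g ^ 2 * f ∣ a ∧ a * b ≡ μ [MOD d]) := by
      rw [hB, Finset.filter_filter]
      refine Finset.filter_congr fun a _ => ?_
      constructor
      · rintro ⟨⟨hga, hab⟩, hfa⟩
        exact ⟨hcop.mul_dvd_of_dvd_of_dvd hga hfa, hab⟩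
      · rintro ⟨hgfa, hab⟩
        exact ⟨⟨(dvd_mul_right _ _).trans hgfa, hab⟩, (dvd_mul_left _ _).trans hgfa⟩
    unfold dvdCongrCount
    rw [hset]
  -- Step 3: `g` with `(g, Q) > 1` or `g > √W` contribute nothing.
  have h4 : ∀ g ∈ Ioc 0 W, ¬ (g ∈ (Ioc 0 (Nat.sqrt W)).filter (fun g => g.Coprime Q)) →
      (ArithmeticFunction.moebius g : ℝ) * ((A.filter fun a => g ^ 2 ∣ a).card : ℝ) = 0 := by
    intro g hg hgnot
    rw [Finset.mem_Ioc] at hg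
    rw [Finset.mem_filter, Finset.mem_Ioc, not_and_or] at hgnot
    suffices hempty : (A.filter fun a => g ^ 2 ∣ a) = ∅ by rw [hempty]; simp
    rw [Finset.filter_eq_empty_iff]
    intro a ha hga
    rw [hA, Finset.mem_filter, Finset.mem_Ioc] at ha
    rcases hgnot with h | h
    · have hlt : Nat.sqrt W < g := by omega
      have : W < g ^ 2 := by rw [sq]; exact Nat.sqrt_lt.mp hlt
      have : g ^ 2 ≤ a := Nat.le_of_dvd ha.1.1 hga
      omega
    · apply h
      exact Nat.Coprime.coprime_dvd_left ((dvd_pow_self g two_ne_zero).trans hga) ha.2.1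
  rw [h1, h2]
  symm
  rw [← Finset.sum_subset (s₁ := (Ioc 0 (Nat.sqrt W)).filter (fun g => g.Coprime Q)) (s₂ := Ioc 0 W)]
  · refine Finset.sum_congr rfl fun g hg => ?_
    rw [Finset.mem_filter, Finset.mem_Ioc] at hg
    rw [h3 g hg.1.1 hg.2]
  · intro g hg
    rw [Finset.mem_filter, Finset.mem_Ioc] at hg
    rw [Finset.mem_Ioc]
    exact ⟨hg.1.1, hg.1.2.trans (Nat.sqrt_le_self W)⟩
  · exact h4

/-- `∑_{f ∣ n} μ(f)/f = φ(n)/n` (local copy of `SquarefreeSums.sum_divisors_moebius_div`). [folklore] -/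
theorem sum_divisors_moebius_div_eq (n : ℕ) (hn : n ≠ 0) :
    ∑ f ∈ n.divisors, (ArithmeticFunction.moebius f : ℝ) / f = (Nat.totient n : ℝ) / n :=
  SquarefreeSums.sum_divisors_moebius_div n hn

/-- **Squarefree numbers with coprimality and congruence conditions.**  For `Q` squarefree,
`d ∣ Q`, `(b, d) = (μ, d) = 1` and `G ≥ ⌊√W⌋`:
`|SF(W; Q, d, b, μ) − (φ(Q/d)/Q) S_Q(G) W| ≤ (τ(Q) + 1) √W + 3`.
(p. 179 counts these via `ρ = 1 * χ₄`; the density `φ(Q/d)/Q · 6/π² ∏_{p∣Q}(1−p^{-2})^{-1}` is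
the corrected one, cf. arXiv:1910.02885 Lemma 12.) [cite: IwaniecInventiones1978, §4 proof of Lemma 4] -/
theorem abs_sfCount_sub_le (hQ : Squarefree Q) (hdQ : d ∣ Q) (hbd : b.Coprime d) (hμ : μ.Coprime d)
    {G : ℕ} (hG : Nat.sqrt W ≤ G) :
    |(sfCount W Q d b μ : ℝ) - (Nat.totient (Q / d) : ℝ) / Q * sqfSeries Q G * W| ≤
      ((Nat.divisors Q).card + 1) * Real.sqrt W + 3 := by
  classical
  have hQ0 : Q ≠ 0 := hQ.ne_zero
  have hd0 : 0 < d := Nat.pos_of_dvd_of_pos hdQ (Nat.pos_of_ne_zero hQ0)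
  set Q' := Q / d with hQ'
  have hQeq : Q' * d = Q := Nat.div_mul_cancel hdQ
  have hQ'0 : Q' ≠ 0 := by intro h; rw [h, zero_mul] at hQeq; exact hQ0 hQeq.symm
  have hQ'd : Q'.Coprime d := by
    have := hQ; rw [← hQeq, Nat.squarefree_mul_iff] at this; exact this.1
  set K := Nat.sqrt W with hK
  set Gs := (Ioc 0 K).filter (fun g => g.Coprime Q) with hGs
  have hτ : (Q'.divisors.card : ℝ) ≤ (Q.divisors.card : ℝ) := by
    exact_mod_cast Finset.card_le_card (Nat.divisors_subset_of_dvd hQ0 (Dvd.intro d hQeq))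
  have hKW : (K : ℝ) ≤ Real.sqrt W := by
    rw [Real.le_sqrt (Nat.cast_nonneg _) (Nat.cast_nonneg _)]
    exact_mod_cast Nat.sqrt_le' W
  have hsqrt0 : 0 ≤ Real.sqrt W := Real.sqrt_nonneg _
  -- the identity and the termwise approximation
  rw [sfCount_eq_sum hQ hdQ hμ]
  set main : ℝ := ∑ g ∈ Gs, (ArithmeticFunction.moebius g : ℝ) *
      ∑ f ∈ Q'.divisors, (ArithmeticFunction.moebius f : ℝ) * ((W : ℝ) / (g ^ 2 * f * d)) with hmain
  have hstep1 : |∑ g ∈ Gs, (ArithmeticFunction.moebius g : ℝ) *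
        ∑ f ∈ Q'.divisors, (ArithmeticFunction.moebius f : ℝ) * (dvdCongrCount W (g ^ 2 * f) d b μ : ℝ)
        - main| ≤ K * Q'.divisors.card := by
    rw [hmain, ← Finset.sum_sub_distrib]
    calc |∑ g ∈ Gs, ((ArithmeticFunction.moebius g : ℝ) *
            ∑ f ∈ Q'.divisors, (ArithmeticFunction.moebius f : ℝ) * (dvdCongrCount W (g ^ 2 * f) d b μ : ℝ) -
            (ArithmeticFunction.moebius g : ℝ) *
            ∑ f ∈ Q'.divisors, (ArithmeticFunction.moebius f : ℝ) * ((W : ℝ) / (g ^ 2 * f * d)))|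
        ≤ ∑ g ∈ Gs, |(ArithmeticFunction.moebius g : ℝ) *
            ∑ f ∈ Q'.divisors, (ArithmeticFunction.moebius f : ℝ) * (dvdCongrCount W (g ^ 2 * f) d b μ : ℝ) -
            (ArithmeticFunction.moebius g : ℝ) *
            ∑ f ∈ Q'.divisors, (ArithmeticFunction.moebius f : ℝ) * ((W : ℝ) / (g ^ 2 * f * d))| :=
          Finset.abs_sum_le_sum_abs _ _
      _ ≤ ∑ g ∈ Gs, (Q'.divisors.card : ℝ) := by
          refine Finset.sum_le_sum fun g hg => ?_
          rw [hGs, Finset.mem_filter, Finset.mem_Ioc] at hg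
          rw [← mul_sub, ← Finset.sum_sub_distrib, abs_mul]
          have hμg : |(ArithmeticFunction.moebius g : ℝ)| ≤ 1 := by
            exact_mod_cast ArithmeticFunction.abs_moebius_le_one
          calc |(ArithmeticFunction.moebius g : ℝ)| *
                |∑ f ∈ Q'.divisors, ((ArithmeticFunction.moebius f : ℝ) * (dvdCongrCount W (g ^ 2 * f) d b μ : ℝ) -
                  (ArithmeticFunction.moebius f : ℝ) * ((W : ℝ) / (g ^ 2 * f * d)))|
              ≤ 1 * ∑ f ∈ Q'.divisors, (1 : ℝ) := by
                refine mul_le_mul hμg ?_ (abs_nonneg _) zero_le_one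
                refine (Finset.abs_sum_le_sum_abs _ _).trans (Finset.sum_le_sum fun f hf => ?_)
                have hf0 : 0 < f := Nat.pos_of_mem_divisors hf
                have hfQ' : f ∣ Q' := Nat.dvd_of_mem_divisors hf
                rw [← mul_sub, abs_mul]
                have hμf : |(ArithmeticFunction.moebius f : ℝ)| ≤ 1 := by
                  exact_mod_cast ArithmeticFunction.abs_moebius_le_one
                refine (mul_le_mul hμf ?_ (abs_nonneg _) zero_le_one).trans (by rw [one_mul])
                have hgd : g.Coprime d := Nat.Coprime.coprime_dvd_right hdQ hg.2
                have hfd : f.Coprime d := Nat.Coprime.coprime_dvd_left hfQ' hQ'd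
                have hed : (g ^ 2 * f).Coprime d := Nat.Coprime.mul_left (hgd.pow_left 2) hfd
                have := abs_dvdCongrCount_sub_le (W := W) (μ := μ) (Nat.mul_pos (pow_pos hg.1.1 2) hf0)
                  hd0 hed hbd
                push_cast at this
                exact this
            _ = Q'.divisors.card := by simp
      _ ≤ K * Q'.divisors.card := by
          rw [Finset.sum_const, nsmul_eq_mul]
          have : (Gs.card : ℝ) ≤ K := by
            have h : Gs.card ≤ K := by
              calc Gs.card ≤ (Ioc 0 K).card := Finset.card_filter_le _ _
                _ = K := by simp
            exact_mod_cast h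
          exact mul_le_mul_of_nonneg_right this (Nat.cast_nonneg _)
  -- the main term factorises
  have hstep2 : main = (W : ℝ) / d * (sqfSeries Q K * ((Nat.totient Q' : ℝ) / Q')) := by
    rw [← sum_divisors_moebius_div_eq Q' hQ'0, sqfSeries, Finset.sum_mul_sum, hmain, Finset.mul_sum]
    refine Finset.sum_congr rfl fun g hg => ?_
    rw [Finset.mul_sum, Finset.mul_sum]
    refine Finset.sum_congr rfl fun f hf => ?_
    rw [Finset.mem_filter, Finset.mem_Ioc] at hg
    have hg0 : (g : ℝ) ≠ 0 := by exact_mod_cast hg.1.1.ne'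
    have hf0 : (f : ℝ) ≠ 0 := by exact_mod_cast (Nat.pos_of_mem_divisors hf).ne'
    have hd0' : (d : ℝ) ≠ 0 := by exact_mod_cast hd0.ne'
    field_simp
  -- the truncation `K → G` of the singular series costs `W/K ≤ K + 2`
  have hstep3 : |main - (Nat.totient Q' : ℝ) / Q * sqfSeries Q G * W| ≤ K + 2 := by
    have hT : (Nat.totient Q' : ℝ) / Q * sqfSeries Q G * W =
        (W : ℝ) / d * (sqfSeries Q G * ((Nat.totient Q' : ℝ) / Q')) := by
      rw [← hQeq]
      have hQ'0' : (Q' : ℝ) ≠ 0 := by exact_mod_cast hQ'0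
      have hd0' : (d : ℝ) ≠ 0 := by exact_mod_cast hd0.ne'
      push_cast
      field_simp
    rw [hstep2, hT, ← mul_sub, ← sub_mul, abs_mul, abs_mul]
    rcases Nat.eq_zero_or_pos W with hW | hW
    · simp [hW]; positivity
    have hK1 : 1 ≤ K := by rw [hK, Nat.le_sqrt]; omega
    have hφ : |(Nat.totient Q' : ℝ) / Q'| ≤ 1 := by
      rw [abs_of_nonneg (by positivity), div_le_one (by exact_mod_cast Nat.pos_of_ne_zero hQ'0)]
      exact_mod_cast Nat.totient_le Q'
    have hWd : |(W : ℝ) / d| ≤ W := by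
      rw [abs_of_nonneg (by positivity), div_le_iff₀ (by exact_mod_cast hd0)]
      have : (1 : ℝ) ≤ d := by exact_mod_cast hd0
      nlinarith [(Nat.cast_nonneg W : (0 : ℝ) ≤ W)]
    have hS : |sqfSeries Q K - sqfSeries Q G| ≤ 1 / K := by
      rw [abs_sub_comm]; exact abs_sqfSeries_sub_le hK1 hG
    have hK0 : (0 : ℝ) < K := by exact_mod_cast hK1
    have hWK : (W : ℝ) ≤ (K : ℝ) ^ 2 + 2 * K := by
      have h := Nat.lt_succ_sqrt W
      have h' : W + 1 ≤ (K + 1) * (K + 1) := h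
      have h'' : ((W + 1 : ℕ) : ℝ) ≤ (((K + 1) * (K + 1) : ℕ) : ℝ) := by exact_mod_cast h'
      push_cast at h''
      nlinarith
    calc |(W : ℝ) / d| * (|sqfSeries Q K - sqfSeries Q G| * |(Nat.totient Q' : ℝ) / Q'|)
        ≤ W * (1 / K * 1) := by
          refine mul_le_mul hWd (mul_le_mul hS hφ (abs_nonneg _) (by positivity)) (by positivity)
            (Nat.cast_nonneg _)
      _ = W / K := by ring
      _ ≤ K + 2 := by
          rw [div_le_iff₀ hK0]
          nlinarith
  -- assembly
  have hτ' : (K : ℝ) * Q'.divisors.card ≤ Q.divisors.card * Real.sqrt W := by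
    rw [mul_comm]
    exact mul_le_mul hτ hKW (Nat.cast_nonneg _) (Nat.cast_nonneg _)
  calc |∑ g ∈ Gs, (ArithmeticFunction.moebius g : ℝ) *
          ∑ f ∈ Q'.divisors, (ArithmeticFunction.moebius f : ℝ) * (dvdCongrCount W (g ^ 2 * f) d b μ : ℝ) -
          (Nat.totient Q' : ℝ) / Q * sqfSeries Q G * W|
      ≤ |∑ g ∈ Gs, (ArithmeticFunction.moebius g : ℝ) *
          ∑ f ∈ Q'.divisors, (ArithmeticFunction.moebius f : ℝ) * (dvdCongrCount W (g ^ 2 * f) d b μ : ℝ) -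
          main| + |main - (Nat.totient Q' : ℝ) / Q * sqfSeries Q G * W| := abs_sub_le _ _ _
    _ ≤ K * Q'.divisors.card + (K + 2) := add_le_add hstep1 hstep3
    _ ≤ Q.divisors.card * Real.sqrt W + (Real.sqrt W + 2) := by gcongr
    _ ≤ (Q.divisors.card + 1) * Real.sqrt W + 3 := by nlinarith

end SF

/-! ### `χ₄` over an arithmetic progression to an odd modulus -/

/-- `χ₄` has period `4`. [folklore] -/
theorem chi4R_add_four_mul (n k : ℕ) : chi4R (n + 4 * k) = chi4R n := by
  rw [chi4R_eq_ite, chi4R_eq_ite]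
  have h2 : (n + 4 * k) % 2 = n % 2 := by omega
  have h4 : (n + 4 * k) % 4 = n % 4 := by omega
  rw [h2, h4]

/-- For odd `d`: `χ₄(dk + c) = χ₄(d) χ₄(k + dc)` (as `d² ≡ 1 (mod 4)`). [folklore] -/
theorem chi4R_mul_add_eq {d : ℕ} (hd : d % 2 = 1) (k c : ℕ) :
    chi4R (d * k + c) = chi4R d * chi4R (k + d * c) := by
  rw [← chi4R_mul]
  set t := d * d / 4 with ht
  have hdd : d * d % 4 = 1 := by
    have : d % 4 = 1 ∨ d % 4 = 3 := by omega
    rw [Nat.mul_mod]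
    rcases this with h | h <;> rw [h]
  have hd2 : d * d = 4 * t + 1 := by
    have := Nat.div_add_mod (d * d) 4
    omega
  have : d * (k + d * c) = d * k + c + 4 * (t * c) := by
    calc d * (k + d * c) = d * k + d * d * c := by ring
      _ = d * k + (4 * t + 1) * c := by rw [hd2]
      _ = d * k + c + 4 * (t * c) := by ring
  rw [this, chi4R_add_four_mul]

/-- `|∑_{1 ≤ n ≤ x, n ≡ c (mod d)} χ₄(n)| ≤ 1` for odd `d`. [folklore] -/
theorem abs_sum_Icc_chi4R_modEq_le_one {d : ℕ} (hd : d % 2 = 1) (c x : ℕ) :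
    |∑ n ∈ (Icc 1 x).filter (fun n => n ≡ c [MOD d]), chi4R n| ≤ 1 := by
  have hd0 : 0 < d := by omega
  -- a representative `c'` of the class with `1 ≤ c' ≤ d`
  obtain ⟨c', hc'1, hc'd, hcc'⟩ : ∃ c' : ℕ, 1 ≤ c' ∧ c' ≤ d ∧ c % d = c' % d := by
    by_cases h0 : c % d = 0
    · exact ⟨d, hd0, le_rfl, by rw [h0, Nat.mod_self]⟩
    · exact ⟨c % d, Nat.pos_of_ne_zero h0, (Nat.mod_lt c hd0).le, (Nat.mod_mod c d).symm⟩
  have hfilter : (Icc 1 x).filter (fun n => n ≡ c [MOD d]) =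
      (Icc 1 x).filter (fun n => n % d = c' % d) := by
    refine Finset.filter_congr fun n _ => ?_
    rw [Nat.ModEq, hcc']
  rw [hfilter]
  by_cases hcx : c' ≤ x
  swap
  · have : (Icc 1 x).filter (fun n => n % d = c' % d) = ∅ := by
      rw [Finset.filter_eq_empty_iff]
      intro n hn h
      rw [Finset.mem_Icc] at hn
      have hnlt : n < d := by omega
      rw [Nat.mod_eq_of_lt hnlt] at h
      rcases hc'd.lt_or_eq with hcl | hcl
      · rw [Nat.mod_eq_of_lt hcl] at h; omega
      · rw [hcl, Nat.mod_self] at h; omega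
    rw [this, Finset.sum_empty, abs_zero]; exact zero_le_one
  rw [Literature.NumberTheory.LFunctions.filter_mod_eq_image hc'1 hc'd hcx, Finset.sum_image]
  swap
  · intro k₁ _ k₂ _ h
    have := mul_left_cancel₀ hd0.ne' (Nat.add_right_cancel h)
    exact this
  set K := (x - c') / d
  have hterm : ∀ k ∈ Icc 0 K, chi4R (d * k + c') = chi4R d * chi4R (k + d * c') :=
    fun k _ => chi4R_mul_add_eq hd k c'
  rw [Finset.sum_congr rfl hterm, ← Finset.mul_sum, abs_mul]
  have hshift : ∑ k ∈ Icc 0 K, chi4R (k + d * c') = ∑ n ∈ Ico (0 + d * c') (K + 1 + d * c'), chi4R n := by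
    rw [← Finset.sum_Ico_add', show Icc 0 K = Ico 0 (K + 1) by rfl]
  rw [hshift]
  calc |chi4R d| * |∑ n ∈ Ico (0 + d * c') (K + 1 + d * c'), chi4R n| ≤ 1 * 1 :=
        mul_le_mul (abs_chi4R_le_one d) (abs_sum_Ico_chi4R_le _ _) (abs_nonneg _) zero_le_one
    _ = 1 := one_mul 1

/-- `|∑_{A < n ≤ B, n ≡ c (mod d)} χ₄(n)| ≤ 2` for odd `d`. [folklore] -/
theorem abs_sum_Ioc_chi4R_modEq_le {d : ℕ} (hd : d % 2 = 1) (c A B : ℕ) :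
    |∑ n ∈ (Ioc A B).filter (fun n => n ≡ c [MOD d]), chi4R n| ≤ 2 := by
  rcases le_or_gt A B with hAB | hAB
  · have hsplit : (Ioc 0 B).filter (fun n => n ≡ c [MOD d]) =
        (Ioc 0 A).filter (fun n => n ≡ c [MOD d]) ∪ (Ioc A B).filter (fun n => n ≡ c [MOD d]) := by
      rw [← Finset.filter_union, Finset.Ioc_union_Ioc_eq_Ioc (Nat.zero_le A) hAB]
    have hdisj : Disjoint ((Ioc 0 A).filter (fun n => n ≡ c [MOD d]))
        ((Ioc A B).filter (fun n => n ≡ c [MOD d])) := by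
      refine Finset.disjoint_filter_filter (Finset.disjoint_left.mpr fun x hx hx' => ?_)
      rw [Finset.mem_Ioc] at hx hx'
      omega
    have heq : ∑ n ∈ (Ioc A B).filter (fun n => n ≡ c [MOD d]), chi4R n =
        ∑ n ∈ (Ioc 0 B).filter (fun n => n ≡ c [MOD d]), chi4R n -
          ∑ n ∈ (Ioc 0 A).filter (fun n => n ≡ c [MOD d]), chi4R n := by
      rw [hsplit, Finset.sum_union hdisj]; ring
    rw [heq]
    have h1 := abs_sum_Icc_chi4R_modEq_le_one hd c B
    have h2 := abs_sum_Icc_chi4R_modEq_le_one hd c A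
    rw [show Icc 1 B = Ioc 0 B from Finset.Icc_add_one_left_eq_Ioc 0 B] at h1
    rw [show Icc 1 A = Ioc 0 A from Finset.Icc_add_one_left_eq_Ioc 0 A] at h2
    calc _ ≤ |∑ n ∈ (Ioc 0 B).filter (fun n => n ≡ c [MOD d]), chi4R n| +
          |∑ n ∈ (Ioc 0 A).filter (fun n => n ≡ c [MOD d]), chi4R n| := abs_sub _ _
      _ ≤ 1 + 1 := add_le_add h1 h2
      _ = 2 := by norm_num
  · rw [Finset.Ioc_eq_empty (by omega), Finset.filter_empty, Finset.sum_empty, abs_zero]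
    norm_num

/-! ### Divisibility re-indexing and the inner sums of the hyperbola method -/

/-- `∑_{E < b ≤ T, f ∣ b} g(b) = ∑_{E/f < b' ≤ T/f} g(f b')`. [folklore] -/
theorem sum_filter_dvd_Ioc_eq {f : ℕ} (hf : 0 < f) (E T : ℕ) (g : ℕ → ℝ) :
    ∑ b ∈ (Ioc E T).filter (fun b => f ∣ b), g b = ∑ b' ∈ Ioc (E / f) (T / f), g (f * b') := by
  have himage : (Ioc E T).filter (fun b => f ∣ b) = (Ioc (E / f) (T / f)).image (fun b' => f * b') := by
    ext b
    simp only [Finset.mem_filter, Finset.mem_Ioc, Finset.mem_image]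
    constructor
    · rintro ⟨⟨h1, h2⟩, ⟨b', rfl⟩⟩
      refine ⟨b', ⟨?_, ?_⟩, rfl⟩
      · rw [Nat.div_lt_iff_lt_mul hf]; rw [mul_comm]; exact h1
      · rw [Nat.le_div_iff_mul_le hf]; rw [mul_comm]; exact h2
    · rintro ⟨b', ⟨h1, h2⟩, rfl⟩
      rw [Nat.div_lt_iff_lt_mul hf] at h1
      rw [Nat.le_div_iff_mul_le hf] at h2
      refine ⟨⟨by rw [mul_comm]; exact h1, by rw [mul_comm]; exact h2⟩, dvd_mul_right _ _⟩
  rw [himage, Finset.sum_image]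
  intro x _ y _ h
  exact mul_left_cancel₀ hf.ne' h

/-- **The inner sums of "part B"**: for `d` odd, `Q'` squarefree... precisely `(Q', d) = 1`, `Q' ≠ 0`,
`(a, d) = 1`:  `|∑_{E < b ≤ T, (b, Q') = 1, a b ≡ μ (d)} χ₄(b)| ≤ 2 τ(Q')`
(Möbius over `f ∣ Q'`, `b = f b'`, `χ₄(f b') = χ₄(f) χ₄(b')`, and the previous lemma). [folklore] -/
theorem abs_sum_chi4R_coprime_modEq_le {Q' d a μ : ℕ} (hd : d % 2 = 1) (hQ'0 : Q' ≠ 0)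
    (hQ'd : Q'.Coprime d) (had : a.Coprime d) (E T : ℕ) :
    |∑ b ∈ (Ioc E T).filter (fun b => b.Coprime Q' ∧ a * b ≡ μ [MOD d]), chi4R b| ≤
      2 * Q'.divisors.card := by
  have hd0 : 0 < d := by omega
  -- Möbius detection of `(b, Q') = 1`
  have h1 : ∑ b ∈ (Ioc E T).filter (fun b => b.Coprime Q' ∧ a * b ≡ μ [MOD d]), chi4R b =
      ∑ b ∈ (Ioc E T).filter (fun b => a * b ≡ μ [MOD d]),
        (if b.Coprime Q' then (1 : ℝ) else 0) * chi4R b := by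
    rw [Finset.sum_filter, Finset.sum_filter]
    refine Finset.sum_congr rfl fun b _ => ?_
    by_cases hb : b.Coprime Q' <;> by_cases hab : a * b ≡ μ [MOD d] <;> simp [hb, hab]
  have h2 : ∑ b ∈ (Ioc E T).filter (fun b => a * b ≡ μ [MOD d]),
        (if b.Coprime Q' then (1 : ℝ) else 0) * chi4R b =
      ∑ f ∈ Q'.divisors, (ArithmeticFunction.moebius f : ℝ) *
        ∑ b ∈ ((Ioc E T).filter (fun b => a * b ≡ μ [MOD d])).filter (fun b => f ∣ b), chi4R b := by
    have : ∀ b ∈ (Ioc E T).filter (fun b => a * b ≡ μ [MOD d]),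
        (if b.Coprime Q' then (1 : ℝ) else 0) * chi4R b =
          ∑ f ∈ Q'.divisors, if f ∣ b then (ArithmeticFunction.moebius f : ℝ) * chi4R b else 0 := by
      intro b hb
      rw [Finset.mem_filter, Finset.mem_Ioc] at hb
      rw [ite_coprime_eq_sum_moebius (by omega) hQ'0, Finset.sum_filter, Finset.sum_mul]
      refine Finset.sum_congr rfl fun f _ => ?_
      split_ifs <;> simp
    rw [Finset.sum_congr rfl this, Finset.sum_comm]
    refine Finset.sum_congr rfl fun f _ => ?_
    rw [← Finset.sum_filter, Finset.mul_sum]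
  rw [h1, h2]
  -- each `f`-term is at most `2` in absolute value
  have h3 : ∀ f ∈ Q'.divisors,
      |(ArithmeticFunction.moebius f : ℝ) *
        ∑ b ∈ ((Ioc E T).filter (fun b => a * b ≡ μ [MOD d])).filter (fun b => f ∣ b), chi4R b| ≤ 2 := by
    intro f hf
    have hf0 : 0 < f := Nat.pos_of_mem_divisors hf
    have hfQ' : f ∣ Q' := Nat.dvd_of_mem_divisors hf
    have hfd : f.Coprime d := Nat.Coprime.coprime_dvd_left hfQ' hQ'd
    rw [abs_mul]
    have hμf : |(ArithmeticFunction.moebius f : ℝ)| ≤ 1 := by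
      exact_mod_cast ArithmeticFunction.abs_moebius_le_one
    refine (mul_le_mul hμf ?_ (abs_nonneg _) zero_le_one).trans (by rw [one_mul])
    -- reorder the two filters and substitute `b = f b'`
    have hswap : ((Ioc E T).filter (fun b => a * b ≡ μ [MOD d])).filter (fun b => f ∣ b) =
        ((Ioc E T).filter (fun b => f ∣ b)).filter (fun b => a * b ≡ μ [MOD d]) := by
      rw [Finset.filter_filter, Finset.filter_filter]
      exact Finset.filter_congr fun b _ => and_comm
    rw [hswap, Finset.sum_filter, sum_filter_dvd_Ioc_eq hf0, ← Finset.sum_filter]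
    -- `χ₄(f b') = χ₄(f) χ₄(b')`, and the congruence is a class of `b'` modulo `d`
    obtain ⟨μ', hμ'⟩ := exists_mul_modEq_iff hd0 (Nat.Coprime.mul_left had hfd) μ
    have hset : (Ioc (E / f) (T / f)).filter (fun b' => a * (f * b') ≡ μ [MOD d]) =
        (Ioc (E / f) (T / f)).filter (fun b' => b' ≡ μ' [MOD d]) := by
      refine Finset.filter_congr fun b' _ => ?_
      rw [← hμ' b', show a * (f * b') = b' * (a * f) by ring]
    rw [hset]
    have : ∑ b' ∈ (Ioc (E / f) (T / f)).filter (fun b' => b' ≡ μ' [MOD d]), chi4R (f * b') =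
        chi4R f * ∑ b' ∈ (Ioc (E / f) (T / f)).filter (fun b' => b' ≡ μ' [MOD d]), chi4R b' := by
      rw [Finset.mul_sum]
      exact Finset.sum_congr rfl fun b' _ => chi4R_mul f b'
    rw [this, abs_mul]
    calc |chi4R f| * |∑ b' ∈ (Ioc (E / f) (T / f)).filter (fun b' => b' ≡ μ' [MOD d]), chi4R b'|
        ≤ 1 * 2 := mul_le_mul (abs_chi4R_le_one f) (abs_sum_Ioc_chi4R_modEq_le hd μ' _ _)
          (abs_nonneg _) zero_le_one
      _ = 2 := by norm_num
  calc |∑ f ∈ Q'.divisors, (ArithmeticFunction.moebius f : ℝ) *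
          ∑ b ∈ ((Ioc E T).filter (fun b => a * b ≡ μ [MOD d])).filter (fun b => f ∣ b), chi4R b|
      ≤ ∑ f ∈ Q'.divisors, |(ArithmeticFunction.moebius f : ℝ) *
          ∑ b ∈ ((Ioc E T).filter (fun b => a * b ≡ μ [MOD d])).filter (fun b => f ∣ b), chi4R b| :=
        Finset.abs_sum_le_sum_abs _ _
    _ ≤ ∑ f ∈ Q'.divisors, (2 : ℝ) := Finset.sum_le_sum h3
    _ = 2 * Q'.divisors.card := by rw [Finset.sum_const, nsmul_eq_mul, mul_comm]

/-- `∑_{b ≤ E} 1/√b ≤ 2 √E` (telescoping `1/√b ≤ 2(√b − √(b−1))`). [folklore] -/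
theorem sum_inv_sqrt_le (E : ℕ) : ∑ b ∈ Ioc 0 E, 1 / Real.sqrt b ≤ 2 * Real.sqrt E := by
  induction E with
  | zero => simp
  | succ E ih =>
    rw [Finset.sum_Ioc_succ_top (Nat.zero_le E)]
    have hE0 : (0 : ℝ) ≤ E := Nat.cast_nonneg E
    have hs : 0 < Real.sqrt (E + 1 : ℕ) := Real.sqrt_pos.mpr (by positivity)
    have hkey : 1 / Real.sqrt (E + 1 : ℕ) ≤ 2 * (Real.sqrt (E + 1 : ℕ) - Real.sqrt E) := by
      rw [div_le_iff₀ hs]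
      have h1 : Real.sqrt (E + 1 : ℕ) ^ 2 = E + 1 := by
        rw [Real.sq_sqrt (by positivity)]; push_cast; ring
      have h2 : Real.sqrt E ^ 2 = E := Real.sq_sqrt hE0
      have h3 : Real.sqrt E ≤ Real.sqrt (E + 1 : ℕ) := Real.sqrt_le_sqrt (by push_cast; linarith)
      nlinarith [Real.sqrt_nonneg E]
    linarith

/-! ### The hyperbola method: orderings of the double sum -/

/-- Fibres of `{(a, b) : a, b ≥ 1, ab ≤ Y}` over `a`. [folklore] -/
theorem sum_Icc_div_eq_sum_ite {Y a : ℕ} (ha : 1 ≤ a) (F : ℕ → ℝ) :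
    ∑ b ∈ Icc 1 (Y / a), F b = ∑ b ∈ Icc 1 Y, if a * b ≤ Y then F b else 0 := by
  rw [← Finset.sum_filter]
  congr 1
  ext b
  simp only [Finset.mem_Icc, Finset.mem_filter]
  have ha0 : 0 < a := ha
  constructor
  · rintro ⟨h1, h2⟩
    rw [Nat.le_div_iff_mul_le ha0, mul_comm] at h2
    exact ⟨⟨h1, le_trans (by nlinarith) h2⟩, h2⟩
  · rintro ⟨⟨h1, -⟩, h2⟩
    exact ⟨h1, by rw [Nat.le_div_iff_mul_le ha0, mul_comm]; exact h2⟩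

/-- **Swapping the order** in `∑_{ab ≤ Y} F(a, b)`:
`∑_{a ≤ Y} ∑_{b ≤ Y/a} F(a,b) = ∑_{b ≤ Y} ∑_{a ≤ Y/b} F(a,b)`. [folklore] -/
theorem sum_Icc_div_comm (Y : ℕ) (F : ℕ → ℕ → ℝ) :
    ∑ a ∈ Icc 1 Y, ∑ b ∈ Icc 1 (Y / a), F a b = ∑ b ∈ Icc 1 Y, ∑ a ∈ Icc 1 (Y / b), F a b := by
  have hL : ∑ a ∈ Icc 1 Y, ∑ b ∈ Icc 1 (Y / a), F a b =
      ∑ a ∈ Icc 1 Y, ∑ b ∈ Icc 1 Y, if a * b ≤ Y then F a b else 0 :=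
    Finset.sum_congr rfl fun a ha => sum_Icc_div_eq_sum_ite (Finset.mem_Icc.mp ha).1 (F a)
  have hR : ∑ b ∈ Icc 1 Y, ∑ a ∈ Icc 1 (Y / b), F a b =
      ∑ b ∈ Icc 1 Y, ∑ a ∈ Icc 1 Y, if a * b ≤ Y then F a b else 0 := by
    refine Finset.sum_congr rfl fun b hb => ?_
    rw [sum_Icc_div_eq_sum_ite (Finset.mem_Icc.mp hb).1 (fun a => F a b)]
    refine Finset.sum_congr rfl fun a _ => ?_
    rw [mul_comm]
  rw [hL, hR, Finset.sum_comm]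

/-- `∑_{m ≤ Y} ρ(m) c(m) = ∑_{a ≤ Y} ∑_{b ≤ Y/a} μ²(a) χ₄(b) c(ab)`. [folklore] -/
theorem sum_rho_mul_eq_sum_sum (Y : ℕ) (c : ℕ → ℝ) :
    ∑ m ∈ Icc 1 Y, (rho m : ℝ) * c m =
      ∑ a ∈ Icc 1 Y, ∑ b ∈ Icc 1 (Y / a), moebiusSq a * chi4R b * c (a * b) := by
  rw [← sum_Icc_sum_divisorsAntidiagonal (fun a b => moebiusSq a * chi4R b * c (a * b)) Y]
  refine Finset.sum_congr rfl fun m _ => ?_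
  rw [rho_eq_sum_divisorsAntidiagonal, Finset.sum_mul]
  refine Finset.sum_congr rfl fun q hq => ?_
  rw [(Nat.mem_divisorsAntidiagonal.mp hq).1]

/-! ### The mean value of `ρ` with coprimality and congruence conditions -/

/-- `Λ_Q(E) = ∑_{b ≤ E, (b, Q) = 1} χ₄(b)/b` (a truncation of `L(1, χ₄) ∏_{p ∣ Q}(1 − χ₄(p)/p)`).
[folklore] -/
def chiSeries (Q E : ℕ) : ℝ := ∑ b ∈ (Ioc 0 E).filter (fun b => b.Coprime Q), chi4R b / b

/-- `Σ₀(Y; Q, d, μ) = ∑_{m ≤ Y, (m, Q) = 1, m ≡ μ (mod d)} ρ(m)` (p. 179).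
[cite: IwaniecInventiones1978, §4 proof of Lemma 4] -/
def rhoSumAP (Y Q d μ : ℕ) : ℕ :=
  ∑ m ∈ (Ioc 0 Y).filter (fun m => m.Coprime Q ∧ m ≡ μ [MOD d]), rho m

/-- **The mean value of `ρ` with coprimality and congruence conditions** (the arithmetic input of
Iwaniec's Lemma 4 and of the main terms of `W, V, U`, corrected).  For `Q` squarefree, `d ∣ Q`
odd, `(μ, d) = 1`, `1 ≤ E ≤ Y` and `G ≥ ⌊√Y⌋`:
`|∑_{m ≤ Y, (m,Q)=1, m ≡ μ (d)} ρ(m) − (φ(Q/d)/Q) S_Q(G) Λ_Q(E) · Y| ≤ (2τ(Q) + 7)(√Y √E + Y/E)`.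
Proof: `ρ = μ² * χ₄` and Dirichlet's hyperbola method — `b ≤ E`: `χ₄(b) · SF(Y/b; Q, d, b, μ)`
(`abs_sfCount_sub_le`); `b > E`: for each squarefree `a` prime to `Q` an alternating sum
`∑ χ₄(b)` over `b` in a progression, `≤ 2τ(Q)` (`abs_sum_chi4R_coprime_modEq_le`).
[cite: IwaniecInventiones1978, §4 proof of Lemma 4] -/
theorem abs_rhoSumAP_sub_le {Q d μ E Y G : ℕ} (hQ : Squarefree Q) (hdQ : d ∣ Q) (hd2 : d % 2 = 1)
    (hμ : μ.Coprime d) (hE : 1 ≤ E) (hEY : E ≤ Y) (hG : Nat.sqrt Y ≤ G) :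
    |(rhoSumAP Y Q d μ : ℝ) - (Nat.totient (Q / d) : ℝ) / Q * sqfSeries Q G * chiSeries Q E * Y| ≤
      (2 * Q.divisors.card + 7) * (Real.sqrt Y * Real.sqrt E + Y / E) := by
  classical
  have hQ0 : Q ≠ 0 := hQ.ne_zero
  have hd0 : 0 < d := Nat.pos_of_dvd_of_pos hdQ (Nat.pos_of_ne_zero hQ0)
  set Q' := Q / d with hQ'
  have hQeq : Q' * d = Q := Nat.div_mul_cancel hdQ
  have hQ'0 : Q' ≠ 0 := by intro h; rw [h, zero_mul] at hQeq; exact hQ0 hQeq.symm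
  have hQ'd : Q'.Coprime d := by
    have := hQ; rw [← hQeq, Nat.squarefree_mul_iff] at this; exact this.1
  have hτ : (Q'.divisors.card : ℝ) ≤ (Q.divisors.card : ℝ) := by
    exact_mod_cast Finset.card_le_card (Nat.divisors_subset_of_dvd hQ0 (Dvd.intro d hQeq))
  set τ : ℝ := (Q.divisors.card : ℝ) with hτdef
  have hτ0 : 0 ≤ τ := Nat.cast_nonneg _
  set cG : ℝ := (Nat.totient Q' : ℝ) / Q * sqfSeries Q G with hcG
  have hcG2 : |cG| ≤ 2 := by
    rw [hcG, abs_mul]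
    have h1 : |(Nat.totient Q' : ℝ) / Q| ≤ 1 := by
      rw [abs_of_nonneg (by positivity), div_le_one (by exact_mod_cast Nat.pos_of_ne_zero hQ0)]
      have : Nat.totient Q' ≤ Q := (Nat.totient_le Q').trans (Nat.le_of_dvd (Nat.pos_of_ne_zero hQ0)
        (Dvd.intro d hQeq))
      exact_mod_cast this
    calc |(Nat.totient Q' : ℝ) / Q| * |sqfSeries Q G| ≤ 1 * 2 :=
          mul_le_mul h1 (abs_sqfSeries_le Q G) (abs_nonneg _) zero_le_one
      _ = 2 := by norm_num
  have hE0 : (0 : ℝ) < E := by exact_mod_cast hE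
  have hY0 : (0 : ℝ) < Y := by exact_mod_cast (lt_of_lt_of_le hE hEY)
  have hsE : 0 < Real.sqrt E := Real.sqrt_pos.mpr hE0
  have hsY : 0 < Real.sqrt Y := Real.sqrt_pos.mpr hY0
  -- the conditions as a weight `c`
  set c : ℕ → ℝ := fun m => if m.Coprime Q ∧ m ≡ μ [MOD d] then 1 else 0 with hc
  set T : ℕ → ℕ → ℝ := fun a b => moebiusSq a * chi4R b * c (a * b) with hT
  -- Step 1: `Σ₀ = ∑_a ∑_{b ≤ Y/a} T(a, b)`
  have h1 : (rhoSumAP Y Q d μ : ℝ) = ∑ a ∈ Icc 1 Y, ∑ b ∈ Icc 1 (Y / a), T a b := by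
    rw [← sum_rho_mul_eq_sum_sum, rhoSumAP, Nat.cast_sum, Finset.sum_filter,
      show Ioc 0 Y = Icc 1 Y from (Finset.Icc_add_one_left_eq_Ioc 0 Y).symm]
    refine Finset.sum_congr rfl fun m _ => ?_
    by_cases h : m.Coprime Q ∧ m ≡ μ [MOD d]
    · simp only [hc, if_pos h, mul_one]
    · simp only [hc, if_neg h, mul_zero]
  -- Step 2: split at `b ≤ E`
  have h2 : ∑ a ∈ Icc 1 Y, ∑ b ∈ Icc 1 (Y / a), T a b =
      ∑ b ∈ Icc 1 E, ∑ a ∈ Icc 1 (Y / b), T a b +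
        ∑ a ∈ Icc 1 Y, ∑ b ∈ Ioc E (Y / a), T a b := by
    have hsplit : ∀ a b : ℕ, T a b = (if b ≤ E then T a b else 0) + (if E < b then T a b else 0) := by
      intro a b
      by_cases h : b ≤ E
      · rw [if_pos h, if_neg (not_lt.mpr h), add_zero]
      · rw [if_neg h, if_pos (not_le.mp h), zero_add]
    have hA : ∑ a ∈ Icc 1 Y, ∑ b ∈ Icc 1 (Y / a), (if b ≤ E then T a b else 0) =
        ∑ b ∈ Icc 1 E, ∑ a ∈ Icc 1 (Y / b), T a b := by
      rw [sum_Icc_div_comm Y (fun a b => if b ≤ E then T a b else 0)]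
      have : ∀ b ∈ Icc 1 Y, ∑ a ∈ Icc 1 (Y / b), (if b ≤ E then T a b else 0) =
          if b ≤ E then ∑ a ∈ Icc 1 (Y / b), T a b else 0 := by
        intro b _
        split_ifs <;> simp
      rw [Finset.sum_congr rfl this, ← Finset.sum_filter]
      congr 1
      ext b
      simp only [Finset.mem_filter, Finset.mem_Icc]
      omega
    have hB : ∑ a ∈ Icc 1 Y, ∑ b ∈ Icc 1 (Y / a), (if E < b then T a b else 0) =
        ∑ a ∈ Icc 1 Y, ∑ b ∈ Ioc E (Y / a), T a b := by
      refine Finset.sum_congr rfl fun a _ => ?_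
      rw [← Finset.sum_filter]
      congr 1
      ext b
      simp only [Finset.mem_filter, Finset.mem_Icc, Finset.mem_Ioc]
      omega
    rw [← hA, ← hB, ← Finset.sum_add_distrib]
    refine Finset.sum_congr rfl fun a _ => ?_
    rw [← Finset.sum_add_distrib]
    exact Finset.sum_congr rfl fun b _ => hsplit a b
  -- Step 3: part A, termwise: `∑_a T(a, b) = χ₄(b) [(b,Q)=1] SF(Y/b)`
  have h3 : ∀ b ∈ Icc 1 E, ∑ a ∈ Icc 1 (Y / b), T a b =
      if b.Coprime Q then chi4R b * (sfCount (Y / b) Q d b μ : ℝ) else 0 := by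
    intro b _
    by_cases hbQ : b.Coprime Q
    · rw [if_pos hbQ, sfCount, show Ioc 0 (Y / b) = Icc 1 (Y / b) from
        (Finset.Icc_add_one_left_eq_Ioc 0 (Y / b)).symm]
      have : ∀ a ∈ Icc 1 (Y / b), T a b =
          chi4R b * (if Squarefree a ∧ a.Coprime Q ∧ a * b ≡ μ [MOD d] then 1 else 0) := by
        intro a _
        simp only [hT, hc, moebiusSq_apply]
        by_cases h1 : Squarefree a
        · rw [if_pos h1, one_mul]
          by_cases h23 : a.Coprime Q ∧ a * b ≡ μ [MOD d]
          · rw [if_pos ⟨Nat.Coprime.mul_left h23.1 hbQ, h23.2⟩, if_pos ⟨h1, h23⟩]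
          · rw [if_neg (fun h => h23 ⟨Nat.Coprime.coprime_mul_right h.1, h.2⟩),
              if_neg (fun h => h23 h.2)]
        · rw [if_neg h1, zero_mul, zero_mul, if_neg (fun h => h1 h.1), mul_zero]
      rw [Finset.sum_congr rfl this, ← Finset.mul_sum, Finset.sum_boole]
    · rw [if_neg hbQ]
      refine Finset.sum_eq_zero fun a _ => ?_
      simp only [hT, hc]
      rw [if_neg, mul_zero]
      rintro ⟨h, -⟩
      exact hbQ (Nat.Coprime.coprime_mul_left h)
  -- Step 4: part A, the estimate
  have h4 : |∑ b ∈ Icc 1 E, ∑ a ∈ Icc 1 (Y / b), T a b - cG * chiSeries Q E * Y| ≤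
      (τ + 1) * Real.sqrt Y * (2 * Real.sqrt E) + 5 * E := by
    rw [Finset.sum_congr rfl h3, ← Finset.sum_filter, chiSeries,
      show Ioc 0 E = Icc 1 E from (Finset.Icc_add_one_left_eq_Ioc 0 E).symm, Finset.mul_sum,
      Finset.sum_mul, ← Finset.sum_sub_distrib]
    set Bs := (Icc 1 E).filter (fun b => b.Coprime Q) with hBs
    have hper : ∀ b ∈ Bs, |chi4R b * (sfCount (Y / b) Q d b μ : ℝ) - cG * (chi4R b / b) * Y| ≤
        (τ + 1) * Real.sqrt Y * (1 / Real.sqrt b) + 5 := by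
      intro b hb
      rw [hBs, Finset.mem_filter, Finset.mem_Icc] at hb
      have hb0 : (0 : ℝ) < b := by exact_mod_cast hb.1.1
      have hbd : b.Coprime d := Nat.Coprime.coprime_dvd_right hdQ hb.2
      have hsf := abs_sfCount_sub_le (W := Y / b) hQ hdQ hbd hμ
        ((Nat.sqrt_le_sqrt (Nat.div_le_self Y b)).trans hG)
      have hfl : |((Y / b : ℕ) : ℝ) - (Y : ℝ) / b| ≤ 1 := by
        rw [abs_le]
        constructor
        · have := Nat.lt_div_mul_add (a := Y) hb.1.1
          have h' : (Y : ℝ) < ((Y / b : ℕ) : ℝ) * b + b := by exact_mod_cast this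
          rw [div_eq_mul_inv]
          have : (Y : ℝ) * (b : ℝ)⁻¹ < (Y / b : ℕ) + 1 := by
            rw [← div_eq_mul_inv, div_lt_iff₀ hb0]; linarith
          linarith
        · have : ((Y / b : ℕ) : ℝ) ≤ (Y : ℝ) / b := Nat.cast_div_le
          linarith
      have hsq : Real.sqrt ((Y / b : ℕ) : ℝ) ≤ Real.sqrt Y * (1 / Real.sqrt b) := by
        rw [one_div, ← Real.sqrt_inv, ← Real.sqrt_mul (Nat.cast_nonneg Y), ← div_eq_mul_inv]
        exact Real.sqrt_le_sqrt Nat.cast_div_le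
      have heq : chi4R b * (sfCount (Y / b) Q d b μ : ℝ) - cG * (chi4R b / b) * Y =
          chi4R b * (((sfCount (Y / b) Q d b μ : ℝ) - cG * ((Y / b : ℕ) : ℝ)) +
            cG * (((Y / b : ℕ) : ℝ) - (Y : ℝ) / b)) := by ring
      rw [heq, abs_mul]
      have hχ := abs_chi4R_le_one b
      calc |chi4R b| * |((sfCount (Y / b) Q d b μ : ℝ) - cG * ((Y / b : ℕ) : ℝ)) +
            cG * (((Y / b : ℕ) : ℝ) - (Y : ℝ) / b)|
          ≤ 1 * (|(sfCount (Y / b) Q d b μ : ℝ) - cG * ((Y / b : ℕ) : ℝ)| +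
            |cG| * |((Y / b : ℕ) : ℝ) - (Y : ℝ) / b|) := by
            refine mul_le_mul hχ ((abs_add_le _ _).trans (by rw [abs_mul])) (abs_nonneg _) zero_le_one
        _ ≤ 1 * (((τ + 1) * Real.sqrt ((Y / b : ℕ) : ℝ) + 3) + 2 * 1) := by
            gcongr
        _ ≤ (τ + 1) * Real.sqrt Y * (1 / Real.sqrt b) + 5 := by
            have : (τ + 1) * Real.sqrt ((Y / b : ℕ) : ℝ) ≤ (τ + 1) * (Real.sqrt Y * (1 / Real.sqrt b)) :=
              mul_le_mul_of_nonneg_left hsq (by positivity)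
            nlinarith
    calc |∑ b ∈ Bs, (chi4R b * (sfCount (Y / b) Q d b μ : ℝ) - cG * (chi4R b / b) * Y)|
        ≤ ∑ b ∈ Bs, |chi4R b * (sfCount (Y / b) Q d b μ : ℝ) - cG * (chi4R b / b) * Y| :=
          Finset.abs_sum_le_sum_abs _ _
      _ ≤ ∑ b ∈ Bs, ((τ + 1) * Real.sqrt Y * (1 / Real.sqrt b) + 5) := Finset.sum_le_sum hper
      _ ≤ ∑ b ∈ Icc 1 E, ((τ + 1) * Real.sqrt Y * (1 / Real.sqrt b) + 5) :=
          Finset.sum_le_sum_of_subset_of_nonneg (Finset.filter_subset _ _) fun _ _ _ => by positivity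
      _ = (τ + 1) * Real.sqrt Y * ∑ b ∈ Icc 1 E, 1 / Real.sqrt b + 5 * E := by
          rw [Finset.sum_add_distrib, ← Finset.mul_sum, Finset.sum_const, Nat.card_Icc, nsmul_eq_mul]
          push_cast; ring
      _ ≤ (τ + 1) * Real.sqrt Y * (2 * Real.sqrt E) + 5 * E := by
          have := sum_inv_sqrt_le E
          rw [show Ioc 0 E = Icc 1 E from (Finset.Icc_add_one_left_eq_Ioc 0 E).symm] at this
          gcongr
  -- Step 5: part B is small
  have h5 : |∑ a ∈ Icc 1 Y, ∑ b ∈ Ioc E (Y / a), T a b| ≤ 2 * τ * Y / E := by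
    have hper : ∀ a ∈ Icc 1 Y, |∑ b ∈ Ioc E (Y / a), T a b| ≤
        if a ≤ Y / E then 2 * τ else 0 := by
      intro a ha
      rw [Finset.mem_Icc] at ha
      split_ifs with haE
      · by_cases hgood : Squarefree a ∧ a.Coprime Q
        · obtain ⟨hsq, haQ⟩ := hgood
          have had : a.Coprime d := Nat.Coprime.coprime_dvd_right hdQ haQ
          have hTa : ∀ b ∈ Ioc E (Y / a), T a b =
              if b.Coprime Q' ∧ a * b ≡ μ [MOD d] then chi4R b else 0 := by
            intro b _
            simp only [hT, hc, moebiusSq_apply, if_pos hsq, one_mul]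
            by_cases hab : a * b ≡ μ [MOD d]
            · have hbd : b.Coprime d := by
                have h1 : (a * b).Coprime d := by
                  rw [Nat.Coprime, Nat.ModEq.gcd_eq hab]; exact hμ
                exact Nat.Coprime.coprime_mul_left h1
              have hiff : (a * b).Coprime Q ↔ b.Coprime Q' := by
                constructor
                · intro h
                  exact Nat.Coprime.coprime_dvd_right (Dvd.intro d hQeq)
                    (Nat.Coprime.coprime_mul_left h)
                · intro h
                  have hbQ : b.Coprime Q := by rw [← hQeq]; exact Nat.Coprime.mul_right h hbd
                  exact Nat.Coprime.mul_left haQ hbQ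
              by_cases hbQ : b.Coprime Q'
              · rw [if_pos ⟨hiff.mpr hbQ, hab⟩, if_pos ⟨hbQ, hab⟩, mul_one]
              · rw [if_neg (fun h => hbQ (hiff.mp h.1)), if_neg (fun h => hbQ h.1), mul_zero]
            · rw [if_neg (fun h => hab h.2), if_neg (fun h => hab h.2), mul_zero]
          rw [Finset.sum_congr rfl hTa, ← Finset.sum_filter]
          calc _ ≤ 2 * (Q'.divisors.card : ℝ) := abs_sum_chi4R_coprime_modEq_le hd2 hQ'0 hQ'd had E (Y / a)
            _ ≤ 2 * τ := by rw [hτdef]; gcongr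
        · have : ∑ b ∈ Ioc E (Y / a), T a b = 0 := by
            refine Finset.sum_eq_zero fun b _ => ?_
            simp only [hT, hc, moebiusSq_apply]
            by_cases hsq : Squarefree a
            · have haQ : ¬ a.Coprime Q := fun h => hgood ⟨hsq, h⟩
              rw [if_pos hsq, one_mul, if_neg, mul_zero]
              rintro ⟨h, -⟩
              exact haQ (Nat.Coprime.coprime_mul_right h)
            · rw [if_neg hsq, zero_mul, zero_mul]
          rw [this, abs_zero]
          positivity
      · have hempty : Ioc E (Y / a) = ∅ := by
          apply Finset.Ioc_eq_empty
          intro hlt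
          apply haE
          rw [Nat.lt_iff_add_one_le, Nat.le_div_iff_mul_le ha.1] at hlt
          rw [Nat.le_div_iff_mul_le hE]
          nlinarith
        rw [hempty, Finset.sum_empty, abs_zero]
    calc |∑ a ∈ Icc 1 Y, ∑ b ∈ Ioc E (Y / a), T a b|
        ≤ ∑ a ∈ Icc 1 Y, |∑ b ∈ Ioc E (Y / a), T a b| := Finset.abs_sum_le_sum_abs _ _
      _ ≤ ∑ a ∈ Icc 1 Y, (if a ≤ Y / E then 2 * τ else 0) := Finset.sum_le_sum hper
      _ = ∑ a ∈ (Icc 1 Y).filter (fun a => a ≤ Y / E), 2 * τ := (Finset.sum_filter _ _).symm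
      _ ≤ ∑ a ∈ Icc 1 (Y / E), 2 * τ := by
          refine Finset.sum_le_sum_of_subset_of_nonneg ?_ fun _ _ _ => by positivity
          intro a ha
          rw [Finset.mem_filter, Finset.mem_Icc] at ha
          rw [Finset.mem_Icc]
          exact ⟨ha.1.1, ha.2⟩
      _ = (Y / E : ℕ) * (2 * τ) := by rw [Finset.sum_const, Nat.card_Icc, nsmul_eq_mul]; push_cast; ring
      _ ≤ (Y : ℝ) / E * (2 * τ) := mul_le_mul_of_nonneg_right Nat.cast_div_le (by positivity)
      _ = 2 * τ * Y / E := by ring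
  -- Step 6: assembly
  have hmain : (Nat.totient (Q / d) : ℝ) / Q * sqfSeries Q G * chiSeries Q E * Y =
      cG * chiSeries Q E * Y := by rw [hcG]
  rw [hmain, h1, h2]
  have hEs : (E : ℝ) ≤ Real.sqrt Y * Real.sqrt E := by
    rw [← Real.sqrt_mul (Nat.cast_nonneg Y)]
    calc (E : ℝ) = Real.sqrt ((E : ℝ) * E) := by rw [Real.sqrt_mul_self hE0.le]
      _ ≤ Real.sqrt ((Y : ℝ) * E) :=
          Real.sqrt_le_sqrt (mul_le_mul_of_nonneg_right (by exact_mod_cast hEY) (Nat.cast_nonneg E))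
  calc |∑ b ∈ Icc 1 E, ∑ a ∈ Icc 1 (Y / b), T a b + ∑ a ∈ Icc 1 Y, ∑ b ∈ Ioc E (Y / a), T a b -
          cG * chiSeries Q E * Y|
      = |(∑ b ∈ Icc 1 E, ∑ a ∈ Icc 1 (Y / b), T a b - cG * chiSeries Q E * Y) +
          ∑ a ∈ Icc 1 Y, ∑ b ∈ Ioc E (Y / a), T a b| := by ring_nf
    _ ≤ |∑ b ∈ Icc 1 E, ∑ a ∈ Icc 1 (Y / b), T a b - cG * chiSeries Q E * Y| +
          |∑ a ∈ Icc 1 Y, ∑ b ∈ Ioc E (Y / a), T a b| := abs_add_le _ _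
    _ ≤ (τ + 1) * Real.sqrt Y * (2 * Real.sqrt E) + 5 * E + 2 * τ * Y / E := add_le_add h4 h5
    _ ≤ (2 * τ + 7) * (Real.sqrt Y * Real.sqrt E + Y / E) := by
        have hYE : (0 : ℝ) ≤ Y / E := by positivity
        have key : (2 * τ + 7) * (Real.sqrt Y * Real.sqrt E + Y / E) -
            ((τ + 1) * Real.sqrt Y * (2 * Real.sqrt E) + 5 * E + 2 * τ * Y / E) =
            5 * (Real.sqrt Y * Real.sqrt E - E) + 7 * (Y / E) := by ring
        linarith

end Literature.NumberTheory.Sieve.Iwaniec1978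

end
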